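import Summits.BirchSwinnertonDyer.BirchSwinnertonDyer.Theorems.GenusKolyvaginAtTwoPowDvdShaCardAtTwoRTOrthogonalCapstoneFrame
import HarnessLib

/-!
# Route `GenusKolyvaginAtTwo`, LINE 18 (L_T `PowDvdShaCardAtTwoRT`, stmt-BirchSwinnertonDyer-23659, ex 23299/23242) — road (E4)'s
# K-side capstone WITHOUT the published-inputs bundle: `P` is used by the capstone only as «rank E(K) ≤ 1»

Seat `bsd-line-gk2-p4` g21 (WIDTH-5 attach, cell `bsd-f1-sign2`), `--supports stmt-BirchSwinnertonDyer-23659` (helper; closes nothing).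
THEOREMS ONLY (no definition, no named fact, no `sorry`); BSD is not proved by any of this; neither is L_T.

WHAT. `pow_dvd_natCard_sha_of_kolyvaginSupplies_of_orthogonal_of_rank_le_one` is gk2-p2 g20's capstone on L_T's binders
(`pow_dvd_natCard_sha_of_kolyvaginSupplies_of_orthogonal`, `…RTOrthogonalCapstoneFrame`, p737814) with its ONLY use of the displayed
bundle `(hP : PubInputsAtTwo)` — the Kolyvagin conjunct `hP.kolyvagin … : rank E(K) = 1 ∧ Ш(E/K) finite`, consumed once and only as
`rank E(K) ≤ 1` (a generator of `E(K)` modulo torsion, Tian–Yuan–Zhang `exists_generator_mod_torsion`) — replaced by that hypothesis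
itself: `(hrk : (W.baseChange K).mordellWeilRank ≤ 1)`.  Everything else (the two KS supply clauses in the registered shape, X-ORTH in
provenance currency, Q2, the habitat binders) is VERBATIM p737814, and so is the proof (adapted from p737814; one line changed).

WHY. Road (E4) (LEAD ruling R5; skeleton «E4» = {W-UP′ (`exact` under (β″), route rev 37), X-ORTH∃, P}) closes L_T BY NAME modulo the stub
P `stub_pubInputsAtTwo : PubInputsAtTwo` = Gross–Zagier at all levels ∧ Kolyvagin 1990 Thm. A ∧ GZK ∧ modularity ∧ Milne — a print bundle.
Four of its five conjuncts are idle on road (E4), and of Kolyvagin's theorem only the rank inequality is used.  This file makes that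
visible in the kernel: L_T via (E4) is conditional on exactly «rank E(K) ≤ 1 on L_T's habitat», which is Kolyvagin's layer-1/layer-2
EXPONENT descent at 2 (lossy bits allowed) over the in-statement relation Q2 — the same engine as the upper half U_T
(`ShaCardDvdPowAtTwoRT`, stmt-23658).  The closers `…_of_grossWitness_of_orthogonal(_onHabitat)(L)` (gk2-p2) re-cut over this theorem
with `hrk` displayed are one-line edits.

References: [McCallumLMS1991] §4 Prop. 4.7, §5 Prop. 5.2, Thm. 5.4; [GrossLMS1991] §1 Thm. 1.3, §5 Prop. 5.3–5.4, Prop. 6.2;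
[Kolyvagin1991StructureSha]; [Kolyvagin1990] Thm. A; [SilvermanAEC2009] VIII.§2, X.4.2.
-/

set_option autoImplicit false
-- the Theorems namespace of this sub repeats the summit name by design (D-0017 nested layout)
set_option linter.dupNamespace false

noncomputable section

open scoped Classical
open scoped AddSubgroup

namespace Summit.BirchSwinnertonDyer.BirchSwinnertonDyer.Theorems.GenusExact.PlusDescent

open WeierstrassCurve NumberField IsDedekindDomain Field Literature.NumberTheory.EllipticCurves
  Literature.NumberTheory.GaloisRepresentations Literature.NumberTheory.EllipticCurves.ModularForms AddSubgroup
open Summit.BirchSwinnertonDyer.BirchSwinnertonDyer.Theses.GenusKolyvaginAtTwo (KolyvaginRelationAtTwo)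
open Summit.BirchSwinnertonDyer.Rank1Residual

/-- **L_T's CONCLUSION, K-SIDE, FROM THE REGISTERED KS SUPPLIES + X-ORTH (road (E4)), on L_T's own binders, WITH «rank E(K) ≤ 1»
DISPLAYED IN PLACE OF THE PRINT BUNDLE `PubInputsAtTwo`.**  Verbatim gk2-p2's `pow_dvd_natCard_sha_of_kolyvaginSupplies_of_orthogonal`
(p737814) except that `(hP : PubInputsAtTwo)` is replaced by `(hrk : (W.baseChange K).mordellWeilRank ≤ 1)` — the only thing the proof
took from `hP` (via `hP.kolyvagin … .1` and `.le`).  Inputs: Q2, L_T's habitat for `W`, `K`, `(Dt, β, ι, d₁)`, `y_1` of infinite order,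
`¬ 2^{M₀+1} ∣ P(1)`, `τ ≠ 1`; levels `L ≥ M₀ + 1`, `k ≥ M₀`; per-prime predicates `X₊`, `X₋`; a bi-additive `B` on `Ш(E_K)[2^k]` with the
level-kernel clause; X-ORTH in provenance currency; depth minima `Mr` and the two KS supply clauses.  Output: `2^{2M₀} ∣ #Ш(E_K)[2^∞]`.
(Proof adapted from p737814 `…RTOrthogonalCapstoneFrame`, gk2-p2 g20.) [cite: McCallumLMS1991, §4 Prop. 4.7, §5 Prop. 5.2, Thm. 5.4 (p. 310)]
[cite: GrossLMS1991, §5 Prop. 5.3–5.4, Prop. 6.2] [cite: Kolyvagin1991StructureSha] -/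
theorem pow_dvd_natCard_sha_of_kolyvaginSupplies_of_orthogonal_of_rank_le_one (hQ2 : KolyvaginRelationAtTwo)
    (W : WeierstrassCurve ℚ) [W.IsElliptic] [W.IsGloballyMinimal] [NeZero (W.conductorNorm ℤ)] (hcm : ¬ W.HasCM)
    (hT : Odd W.tamagawaProduct) (K : Type) [Field K] [NumberField K] (hIQ : IsImaginaryQuadratic K)
    (hodd : Odd (NumberField.discr K)) (h3 : NumberField.discr K ≠ -3) (hHe : SatisfiesHeegnerHypothesis (W.conductorNorm ℤ) K)
    (hrk : (W.baseChange K).mordellWeilRank ≤ 1)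
    (hρ : ∀ n : ℕ, 0 < n → W.HasSurjectiveModNGaloisRep ((2 : ℤ) ^ n))
    (Dt : ModularParametrizationData W (W.conductorNorm ℤ)) (β : ℤ) (ι : K →+* ℂ) (d₁ : KolyvaginHeegnerData Dt β ι 1)
    (hy : ¬ IsOfFinAddOrder d₁.derivedPoint) (M₀ : ℕ)
    (hndiv : ¬ ∃ Q : (W.baseChange (ringClassField K ι 1)).toAffine.Point, ((2 ^ (M₀ + 1) : ℕ) : ℤ) • Q = d₁.derivedPoint)
    (τ : K ≃ₐ[ℚ] K) (hτ : τ ≠ 1) (L k : ℕ) (hML : M₀ + 1 ≤ L) (hkM : M₀ ≤ k) (Xp Xm : ℕ → Prop)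
    (B : ↥((↥(W.baseChange K).sha)[((2 ^ k : ℕ) : ℤ)]) →+ ↥((↥(W.baseChange K).sha)[((2 ^ k : ℕ) : ℤ)]) →+ AddCircle (1 : ℚ))
    (hker : ∀ x : ↥((↥(W.baseChange K).sha)[((2 ^ k : ℕ) : ℤ)]), B x = 0 →
      ∃ z : (W.baseChange K).sha, (2 ^ k) • z = (x : (W.baseChange K).sha))
    (hOrth : ∀ x x' : ↥((↥(W.baseChange K).sha)[((2 ^ k : ℕ) : ℤ)]),
      (∃ (n : ℕ) (d : KolyvaginHeegnerData Dt β ι n) (e : ℕ), Squarefree n ∧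
        (∀ ℓ ∈ n.primeFactors, Zhang2014.IsKolyvaginPrime (W.conductorNorm ℤ) W K 2 ℓ ∧ L ≤ Zhang2014.kolyvaginIndex W 2 ℓ ∧ Xp ℓ) ∧
        e ≤ k ∧
        ((2 ^ (L - e) : ℕ) : ℤ) • d.kolyvaginClass Nat.prime_two L ∈ selmerGroup (W.baseChange K) ((2 ^ L : ℕ) : ℤ) ∧
        (∀ ℓ ∈ n.primeFactors, ∀ v : HeightOneSpectrum (𝓞 K), ((ℓ : ℕ) : 𝓞 K) ∈ v.asIdeal →
          ((2 ^ (L - e) : ℕ) : ℤ) • d.kolyvaginClass Nat.prime_two L ∈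
            (W.baseChange K).torsionLocalKer (v.adicCompletion K) ((2 ^ L : ℕ) : ℤ)) ∧
        conjAct W τ ((2 ^ L : ℕ) : ℤ) (((2 ^ (L - e) : ℕ) : ℤ) • d.kolyvaginClass Nat.prime_two L) =
          W.rootNumber • (((2 ^ (L - e) : ℕ) : ℤ) • d.kolyvaginClass Nat.prime_two L) ∧
        ((x : (W.baseChange K).sha) : (W.baseChange K).galH1) =
          torsionH1ToH1 (W.baseChange K) ((2 ^ L : ℕ) : ℤ) (((2 ^ (L - e) : ℕ) : ℤ) • d.kolyvaginClass Nat.prime_two L)) →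
      (∃ (n : ℕ) (d : KolyvaginHeegnerData Dt β ι n) (e : ℕ), Squarefree n ∧
        (∀ ℓ ∈ n.primeFactors, Zhang2014.IsKolyvaginPrime (W.conductorNorm ℤ) W K 2 ℓ ∧ L ≤ Zhang2014.kolyvaginIndex W 2 ℓ ∧ Xm ℓ) ∧
        e ≤ k ∧
        ((2 ^ (L - e) : ℕ) : ℤ) • d.kolyvaginClass Nat.prime_two L ∈ selmerGroup (W.baseChange K) ((2 ^ L : ℕ) : ℤ) ∧
        (∀ ℓ ∈ n.primeFactors, ∀ v : HeightOneSpectrum (𝓞 K), ((ℓ : ℕ) : 𝓞 K) ∈ v.asIdeal →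
          ((2 ^ (L - e) : ℕ) : ℤ) • d.kolyvaginClass Nat.prime_two L ∈
            (W.baseChange K).torsionLocalKer (v.adicCompletion K) ((2 ^ L : ℕ) : ℤ)) ∧
        conjAct W τ ((2 ^ L : ℕ) : ℤ) (((2 ^ (L - e) : ℕ) : ℤ) • d.kolyvaginClass Nat.prime_two L) =
          (-W.rootNumber) • (((2 ^ (L - e) : ℕ) : ℤ) • d.kolyvaginClass Nat.prime_two L) ∧
        ((x' : (W.baseChange K).sha) : (W.baseChange K).galH1) =
          torsionH1ToH1 (W.baseChange K) ((2 ^ L : ℕ) : ℤ) (((2 ^ (L - e) : ℕ) : ℤ) • d.kolyvaginClass Nat.prime_two L)) →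
      B x x' = 0)
    (R : ℕ) (Mr : ℕ → ℕ) (hMr : ∀ j, Mr (j + 1) ≤ Mr j) (hMr0 : Mr 0 = M₀) (hMrR : Mr R = 0)
    (hOdd : ∀ m : ℕ, Mr (2 * m + 1) < Mr (2 * m) →
        ∀ (i : ℕ) (u : Fin i → galH1Torsion (W.baseChange K) ((2 ^ L : ℕ) : ℤ)), i ≤ 2 * m + 1 →
        (∀ j, u j ∈ selmerGroup (W.baseChange K) ((2 ^ L : ℕ) : ℤ) ∧
          conjAct W τ ((2 ^ L : ℕ) : ℤ) (u j) = W.rootNumber • u j) →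
        ∃ (n : ℕ) (_ : Squarefree n)
          (_ : ∀ ℓ ∈ n.primeFactors, Zhang2014.IsKolyvaginPrime (W.conductorNorm ℤ) W K 2 ℓ ∧ L ≤ Zhang2014.kolyvaginIndex W 2 ℓ ∧ Xp ℓ)
          (d : KolyvaginHeegnerData Dt β ι n),
          (∀ ℓ ∈ n.primeFactors, ∀ e : KolyvaginHeegnerData Dt β ι (n / ℓ),
            ((2 ^ (L - Mr (2 * m)) : ℕ) : ℤ) • e.kolyvaginClass Nat.prime_two L = 0) ∧
          addOrderOf (d.kolyvaginClass Nat.prime_two L) = 2 ^ (L - Mr (2 * m + 1)) ∧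
          -W.rootNumber * (-1) ^ n.primeFactors.card = W.rootNumber ∧
          Disjoint (zmultiples (((2 ^ (L - Mr (2 * m)) : ℕ) : ℤ) • d.kolyvaginClass Nat.prime_two L))
            (AddSubgroup.closure (Set.range u)))
    (hEven : ∀ m : ℕ, Mr (2 * m + 2) < Mr (2 * m + 1) →
        ∀ (i : ℕ) (u : Fin i → galH1Torsion (W.baseChange K) ((2 ^ L : ℕ) : ℤ)), i ≤ 2 * m + 1 →
        (∀ j, u j ∈ selmerGroup (W.baseChange K) ((2 ^ L : ℕ) : ℤ) ∧
          conjAct W τ ((2 ^ L : ℕ) : ℤ) (u j) = (-W.rootNumber) • u j) →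
        ∃ (n : ℕ) (_ : Squarefree n)
          (_ : ∀ ℓ ∈ n.primeFactors, Zhang2014.IsKolyvaginPrime (W.conductorNorm ℤ) W K 2 ℓ ∧ L ≤ Zhang2014.kolyvaginIndex W 2 ℓ ∧ Xm ℓ)
          (d : KolyvaginHeegnerData Dt β ι n),
          (∀ ℓ ∈ n.primeFactors, ∀ e : KolyvaginHeegnerData Dt β ι (n / ℓ),
            ((2 ^ (L - Mr (2 * m + 1)) : ℕ) : ℤ) • e.kolyvaginClass Nat.prime_two L = 0) ∧
          addOrderOf (d.kolyvaginClass Nat.prime_two L) = 2 ^ (L - Mr (2 * m + 2)) ∧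
          -W.rootNumber * (-1) ^ n.primeFactors.card = -W.rootNumber ∧
          Disjoint (zmultiples (((2 ^ (L - Mr (2 * m + 1)) : ℕ) : ℤ) • d.kolyvaginClass Nat.prime_two L))
            (AddSubgroup.closure (Set.range u) ⊔ zmultiples (d₁.kolyvaginClass Nat.prime_two L))) :
    2 ^ (2 * M₀) ∣ Nat.card (AddCommGroup.primaryComponent (W.baseChange K).sha 2) := by
  have h2 : Module.finrank ℚ K = 2 := hIQ.1
  have hne4 : NumberField.discr K ≠ -4 := fun h ↦ by
    rw [h] at hodd
    exact (Int.not_even_iff_odd.mpr hodd) ⟨-2, by norm_num⟩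
  have hL1 : 1 ≤ L := by omega
  have hn : ((2 ^ L : ℕ) : ℤ) ≠ 0 := by positivity
  -- surjectivity currencies
  have hsurN : ∀ m : ℕ, W.HasSurjectiveModNGaloisRep ((2 ^ m : ℕ) : ℤ) :=
    MinimalTwinBSDTwo.forall_hasSurjectiveModNGaloisRep_two_pow_of_pos W hρ
  have hsurN' : ∀ m : ℕ, W.HasSurjectiveModNGaloisRep (2 ^ m : ℕ) := fun m ↦ by exact_mod_cast hsurN m
  have hsurj1 : W.HasSurjectiveModNGaloisRep ((2 : ℤ) ^ 1) := hρ 1 one_pos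
  have hs2 : W.HasSurjectiveModNGaloisRep 2 := by simpa using hsurj1
  -- the Heegner point `Ph = y_K ↦ P(1)` and `rank E(K) = 1` (Kolyvagin)
  obtain ⟨Ph, hPh, hPhmap⟩ := AdditiveKoly.exists_isHeegnerPoint_map_eq_derivedPoint_one (W := W) (K := K) (Dt := Dt) (β := β)
    (ι := ι) hIQ hHe d₁
  have hnt : ¬ IsOfFinAddOrder Ph := fun h ↦ hy (by
    rw [← hPhmap]
    exact AddMonoidHom.isOfFinAddOrder _ h)
  -- the frame at level `2^L`
  have hdiv : ∀ P : geomPoints (W.baseChange K), ∃ Q : geomPoints (W.baseChange K), ((2 ^ L : ℕ) : ℤ) • Q = P :=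
    (W.baseChange K).zsmul_geomPoints_surjective_of_charZero hn
  have h2tors : ∀ P : (W.baseChange K).toAffine.Point, (2 : ℤ) • P = 0 → P = 0 := fun P hP ↦
    EigenClassesFinite.forall_zsmul_two_pow_baseChange_eq_zero_of_hasSurjectiveModNGaloisRep_two W K h2 hs2 1 P (by simpa using hP)
  haveI hell : (W.baseChange K).IsElliptic := inferInstanceAs ((W.map (algebraMap ℚ K)).IsElliptic)
  obtain ⟨g, hgT⟩ := TianYuanZhang2017.W2.exists_generator_mod_torsion (W.baseChange K) hrk
  have hg : ∀ P : (W.baseChange K).toAffine.Point, ∃ (c : ℤ) (Q : (W.baseChange K).toAffine.Point),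
      ((2 ^ L : ℕ) : ℤ) • Q = P - c • g := fun P ↦ by
    obtain ⟨c, hc⟩ := hgT P
    obtain ⟨Q, hQ⟩ := exists_zsmul_two_pow_eq_of_odd_addOrderOf (W.baseChange K) L (odd_addOrderOf_of_forall_two_smul_eq_zero _ h2tors hc)
    exact ⟨c, Q, hQ⟩
  have hκ := conjAct_kummerMapTorsion_generator_eq W K hIQ hHe τ hτ hdiv h2tors hPh hnt g hgT
  have hP₀ : ∀ Q : (W.baseChange K).toAffine.Point, ((2 ^ L : ℕ) : ℤ) • Q ≠ Ph :=
    forall_two_pow_smul_ne_bottom_of_not_dvd_derivedPoint d₁ Ph hPhmap hML hndiv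
  have hc1 : d₁.kolyvaginClass Nat.prime_two L = kummerMapTorsion (W.baseChange K) ((2 ^ L : ℕ) : ℤ) hdiv Ph :=
    VisiblePairAtTwo.kolyvaginClass_one_two_eq_kummerMapTorsion W K hIQ hodd hHe hsurj1 L d₁ Ph hPhmap
  -- the minima in the large
  have hanti : ∀ a b, a ≤ b → Mr b ≤ Mr a := fun a b hab ↦ by
    induction hab with
    | refl => exact le_rfl
    | step _ ih => exact (hMr _).trans ih
  have hMrM : ∀ j, Mr j ≤ M₀ := fun j ↦ (hanti 0 j (Nat.zero_le j)).trans hMr0.le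
  have hMrL : ∀ j, Mr j ≤ L := fun j ↦ (hMrM j).trans (by omega)
  /- provenance currency: everything Q2 + Gross give about a supplied class `2^{L-M'} c_L(n)` -/
  have hprov : ∀ (X : ℕ → Prop) (s : ℤ) (M' k' : ℕ), k' ≤ M' → M' ≤ L → M' ≤ k → ∀ {n : ℕ} (hn' : Squarefree n)
      (hKolX : ∀ ℓ ∈ n.primeFactors, Zhang2014.IsKolyvaginPrime (W.conductorNorm ℤ) W K 2 ℓ ∧
        L ≤ Zhang2014.kolyvaginIndex W 2 ℓ ∧ X ℓ)
      (d : KolyvaginHeegnerData Dt β ι n),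
      (∀ ℓ ∈ n.primeFactors, ∀ e : KolyvaginHeegnerData Dt β ι (n / ℓ),
        ((2 ^ (L - M') : ℕ) : ℤ) • e.kolyvaginClass Nat.prime_two L = 0) →
      addOrderOf (d.kolyvaginClass Nat.prime_two L) = 2 ^ (L - k') →
      -W.rootNumber * (-1) ^ n.primeFactors.card = s →
      (((2 ^ (L - M') : ℕ) : ℤ) • d.kolyvaginClass Nat.prime_two L ∈ selmerGroup (W.baseChange K) ((2 ^ L : ℕ) : ℤ) ∧
        conjAct W τ ((2 ^ L : ℕ) : ℤ) (((2 ^ (L - M') : ℕ) : ℤ) • d.kolyvaginClass Nat.prime_two L) =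
          s • (((2 ^ (L - M') : ℕ) : ℤ) • d.kolyvaginClass Nat.prime_two L)) ∧
      (∃ (n₀ : ℕ) (d₀ : KolyvaginHeegnerData Dt β ι n₀) (e₀ : ℕ), Squarefree n₀ ∧
        (∀ ℓ ∈ n₀.primeFactors, Zhang2014.IsKolyvaginPrime (W.conductorNorm ℤ) W K 2 ℓ ∧ L ≤ Zhang2014.kolyvaginIndex W 2 ℓ ∧ X ℓ) ∧
        e₀ ≤ k ∧
        ((2 ^ (L - e₀) : ℕ) : ℤ) • d₀.kolyvaginClass Nat.prime_two L ∈ selmerGroup (W.baseChange K) ((2 ^ L : ℕ) : ℤ) ∧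
        (∀ ℓ ∈ n₀.primeFactors, ∀ v : HeightOneSpectrum (𝓞 K), ((ℓ : ℕ) : 𝓞 K) ∈ v.asIdeal →
          ((2 ^ (L - e₀) : ℕ) : ℤ) • d₀.kolyvaginClass Nat.prime_two L ∈
            (W.baseChange K).torsionLocalKer (v.adicCompletion K) ((2 ^ L : ℕ) : ℤ)) ∧
        conjAct W τ ((2 ^ L : ℕ) : ℤ) (((2 ^ (L - e₀) : ℕ) : ℤ) • d₀.kolyvaginClass Nat.prime_two L) =
          s • (((2 ^ (L - e₀) : ℕ) : ℤ) • d₀.kolyvaginClass Nat.prime_two L) ∧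
        ((2 ^ (L - M') : ℕ) : ℤ) • d.kolyvaginClass Nat.prime_two L = ((2 ^ (L - e₀) : ℕ) : ℤ) • d₀.kolyvaginClass Nat.prime_two L) ∧
      addOrderOf (((2 ^ (L - M') : ℕ) : ℤ) • d.kolyvaginClass Nat.prime_two L) = 2 ^ (M' - k') := by
    intro X s M' k' hkM' hML' hMk n hn' hKolX d hsub hordc hsign
    have hKol : ∀ ℓ ∈ n.primeFactors, Zhang2014.IsKolyvaginPrime (W.conductorNorm ℤ) W K 2 ℓ ∧ L ≤ Zhang2014.kolyvaginIndex W 2 ℓ :=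
      fun ℓ hℓ ↦ ⟨(hKolX ℓ hℓ).1, (hKolX ℓ hℓ).2.1⟩
    have hsel := zsmul_kolyvaginClass_two_mem_selmerGroup_of_forall W Dt β ι hQ2 hcm hIQ h3 hne4 hHe hT hsurN' hL1 (L - M') hn' hKol
      d hsub
    have hsg : conjAct W τ ((2 ^ L : ℕ) : ℤ) (((2 ^ (L - M') : ℕ) : ℤ) • d.kolyvaginClass Nat.prime_two L) =
        s • (((2 ^ (L - M') : ℕ) : ℤ) • d.kolyvaginClass Nat.prime_two L) := by
      rw [conjAct_zsmul_kolyvaginClass_two W Dt β ι hIQ h3 hne4 hodd hHe hsurj1 τ hτ hn' hL1 hKol d (L - M'), hsign]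
    have hvan : ∀ ℓ ∈ n.primeFactors, ∀ v : HeightOneSpectrum (𝓞 K), ((ℓ : ℕ) : 𝓞 K) ∈ v.asIdeal →
        ((2 ^ (L - M') : ℕ) : ℤ) • d.kolyvaginClass Nat.prime_two L ∈
          (W.baseChange K).torsionLocalKer (v.adicCompletion K) ((2 ^ L : ℕ) : ℤ) := fun ℓ hℓ v hv ↦
      zsmul_kolyvaginClass_two_mem_torsionLocalKer_of_forall W Dt β ι hQ2 hcm hIQ h3 hne4 hHe hsurN' hL1 (L - M') hn' hKol d hsub hℓ v hv
    exact ⟨⟨hsel, hsg⟩, ⟨n, d, M', hn', hKolX, hMk, hsel, hvan, hsg, rfl⟩,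
      addOrderOf_zsmul_kolyvaginClass_two W Dt β ι d hkM' hML' hordc⟩
  refine pow_dvd_natCard_sha_of_depth_supplies_of_orthogonal W K τ L k hdiv g hg W.rootNumber W.rootNumber_eq_one_or hκ Ph hP₀
    (fun y ↦ ∃ (n : ℕ) (d : KolyvaginHeegnerData Dt β ι n) (e : ℕ), Squarefree n ∧
        (∀ ℓ ∈ n.primeFactors, Zhang2014.IsKolyvaginPrime (W.conductorNorm ℤ) W K 2 ℓ ∧ L ≤ Zhang2014.kolyvaginIndex W 2 ℓ ∧ Xp ℓ) ∧
        e ≤ k ∧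
        ((2 ^ (L - e) : ℕ) : ℤ) • d.kolyvaginClass Nat.prime_two L ∈ selmerGroup (W.baseChange K) ((2 ^ L : ℕ) : ℤ) ∧
        (∀ ℓ ∈ n.primeFactors, ∀ v : HeightOneSpectrum (𝓞 K), ((ℓ : ℕ) : 𝓞 K) ∈ v.asIdeal →
          ((2 ^ (L - e) : ℕ) : ℤ) • d.kolyvaginClass Nat.prime_two L ∈
            (W.baseChange K).torsionLocalKer (v.adicCompletion K) ((2 ^ L : ℕ) : ℤ)) ∧
        conjAct W τ ((2 ^ L : ℕ) : ℤ) (((2 ^ (L - e) : ℕ) : ℤ) • d.kolyvaginClass Nat.prime_two L) =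
          W.rootNumber • (((2 ^ (L - e) : ℕ) : ℤ) • d.kolyvaginClass Nat.prime_two L) ∧
        y = ((2 ^ (L - e) : ℕ) : ℤ) • d.kolyvaginClass Nat.prime_two L)
    (fun y ↦ ∃ (n : ℕ) (d : KolyvaginHeegnerData Dt β ι n) (e : ℕ), Squarefree n ∧
        (∀ ℓ ∈ n.primeFactors, Zhang2014.IsKolyvaginPrime (W.conductorNorm ℤ) W K 2 ℓ ∧ L ≤ Zhang2014.kolyvaginIndex W 2 ℓ ∧ Xm ℓ) ∧
        e ≤ k ∧
        ((2 ^ (L - e) : ℕ) : ℤ) • d.kolyvaginClass Nat.prime_two L ∈ selmerGroup (W.baseChange K) ((2 ^ L : ℕ) : ℤ) ∧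
        (∀ ℓ ∈ n.primeFactors, ∀ v : HeightOneSpectrum (𝓞 K), ((ℓ : ℕ) : 𝓞 K) ∈ v.asIdeal →
          ((2 ^ (L - e) : ℕ) : ℤ) • d.kolyvaginClass Nat.prime_two L ∈
            (W.baseChange K).torsionLocalKer (v.adicCompletion K) ((2 ^ L : ℕ) : ℤ)) ∧
        conjAct W τ ((2 ^ L : ℕ) : ℤ) (((2 ^ (L - e) : ℕ) : ℤ) • d.kolyvaginClass Nat.prime_two L) =
          (-W.rootNumber) • (((2 ^ (L - e) : ℕ) : ℤ) • d.kolyvaginClass Nat.prime_two L) ∧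
        y = ((2 ^ (L - e) : ℕ) : ℤ) • d.kolyvaginClass Nat.prime_two L)
    B hker (fun x x' hx hx' ↦ ?_) M₀ R Mr hMr hMr0 hMrR hkM (fun m hlt i hi u hu hord ↦ ?_) (fun m hlt i hi u hu hord ↦ ?_)
  · -- X-ORTH in provenance currency
    obtain ⟨y, -, ⟨n, d, e, hn', hKol, he, hsel, hvan, hsg, rfl⟩, hx⟩ := hx
    obtain ⟨y', -, ⟨n', d', e', hn'', hKol', he', hsel', hvan', hsg', rfl⟩, hx'⟩ := hx'
    exact hOrth x x' ⟨n, d, e, hn', hKol, he, hsel, hvan, hsg, hx⟩ ⟨n', d', e', hn'', hKol', he', hsel', hvan', hsg', hx'⟩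
  · -- odd depth `2m+1`: sign `w(E)`, no seed
    obtain ⟨n, hn', hKolX, d, hsub, hordc, hsign, hdisj⟩ := hOdd m hlt i u (by omega) hu
    obtain ⟨hP, hprovy, hordy⟩ := hprov Xp W.rootNumber (Mr (2 * m)) (Mr (2 * m + 1)) (hMr _) (hMrL _) ((hMrM _).trans hkM)
      hn' hKolX d hsub hordc hsign
    exact ⟨_, hP, hprovy, hordy, hdisj⟩
  · -- even depth `2m+2`: sign `−w(E)`, seed `⟨c_L(1)⟩ = ⟨δ(Ph)⟩`
    obtain ⟨n, hn', hKolX, d, hsub, hordc, hsign, hdisj⟩ := hEven m hlt i u (by omega) hu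
    obtain ⟨hP, hprovy, hordy⟩ := hprov Xm (-W.rootNumber) (Mr (2 * m + 1)) (Mr (2 * m + 2)) (hMr _) (hMrL _)
      ((hMrM _).trans hkM) hn' hKolX d hsub hordc hsign
    exact ⟨_, hP, hprovy, hordy, by rwa [hc1] at hdisj⟩

end Summit.BirchSwinnertonDyer.BirchSwinnertonDyer.Theorems.GenusExact.PlusDescent

end
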